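import Summits.QuantumFields.YangMills.Theorems.LuscherReductionRunningReductionUniformFloor
import Summits.QuantumFields.YangMills.Theorems.LuscherReductionRunningReductionLatticeLargeField
import Summits.QuantumFields.YangMills.Theorems.LuscherReductionOneSiteLevelsVariational
import Summits.QuantumFields.YangMills.Theorems.FemtoTransferGapSlabRayleigh
import Summits.QuantumFields.YangMills.Theorems.FemtoTransferGapGroundState
import HarnessLib

/-!
# Off-tube suppression for the zero-flux `SU(2)` transfer form on `(ℤ/L)³` — preliminaries
# (crux K2 `OffTubeSuppression` of route `FlatTubeReduction`, item stmt-QuantumFields-24721; rung R2b1 = RECORD-label femto gap)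

Seat `ym-line-sfw-p1` g9 (prover; planner-of-record ym-idea-1).  Bookkeeping for the re-orthogonalised action-tube truncation
`ψ' = 1_Tψ − a·1_TΩ` (`T = {S ≤ η}` the action tube, `Ω` the exact positive ground state) proved in `FlatTubeReductionOffTubeSuppression.lean`:
* §1 indicator cut-offs `1_T ψ` by a measurable gauge- and twist-invariant set (in particular the action tube, `wilsonAction_gaugeTransform`,
  `wilsonAction_twist_of_mem_center`) of a physical zero-flux test function are physical;
* §2 `l2` splitting along `T`/`Tᶜ`;
* §3 transfer-form bookkeeping: `⟨f,K_βf⟩ ≤ λ₀‖f‖²`, `⟨f,K_βΩ⟩ = λ⟨f,Ω⟩` for an exact eigenfunction, right additivity / homogeneity, square expansions;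
* §4 the two estimates, with `κ = e^{−βη}c_β^{|E|}` (RED lane's large-field suppression `qform_le_exp_neg_of_action_ge_lat` + Cauchy–Schwarz
  `sq_qform_le`): ★ `tail_bound` — `λ₀‖1_{Tᶜ}Ω‖² ≤ κ‖Ω‖²` when `K_βΩ = λ₀Ω` and `Tᶜ ⊆ {S ≥ η}`; ★ `sq_cross_le` — `⟨f,K_βg⟩² ≤ λ₀‖f‖²·κ‖g‖²`
  for `g` supported in `{S ≥ η}`;
* §5 the asymptotic smallness condition `β²e^{−β·β^{−θ}} ≤ c` eventually (`θ < 1`).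

HONEST FRAMING: fixed-lattice Hilbert-space bookkeeping; R2b1 is a RECORD rung — nothing here concerns infinite volume, the continuum, or the Clay
Yang–Mills mass gap.  No definitions, no named facts, no `sorry`.
-/

set_option autoImplicit false

noncomputable section

open MeasureTheory Filter Topology Real
open Literature.MathematicalPhysics.QuantumFieldTheory
open Literature.MathematicalPhysics.QuantumLattice

namespace Summit.QuantumFields.YangMills.Theorems.FemtoTransferGap

namespace OffTube

variable {L : ℕ} [NeZero L]

/-! ## §1 Invariant indicator cut-offs of physical test functions are physical -/

omit [NeZero L] in
/-- The indicator cut-off `1_T ψ` of a physical zero-flux test function by a measurable, gauge- and twist-invariant set `T` is physical.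
[folklore] -/
theorem isPhys_indicator {T : Set (GaugeConfig 3 L SU2)} (hT : MeasurableSet T)
    (hTg : ∀ (g : Site 3 L → SU2) (U : GaugeConfig 3 L SU2), gaugeTransform g U ∈ T ↔ U ∈ T)
    (hTz : ∀ (k : Fin 3), ∀ z ∈ Subgroup.center SU2, ∀ U : GaugeConfig 3 L SU2, twist k z U ∈ T ↔ U ∈ T)
    {ψ : GaugeConfig 3 L SU2 → ℝ} (hψ : IsPhys ψ) : IsPhys (T.indicator ψ) where
  measurable := hψ.measurable.indicator hT
  bounded := by
    obtain ⟨C, hC⟩ := hψ.bounded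
    refine ⟨C, fun U => ?_⟩
    by_cases hU : U ∈ T
    · rw [Set.indicator_of_mem hU]; exact hC U
    · rw [Set.indicator_of_notMem hU, abs_zero]; exact (abs_nonneg _).trans (hC U)
  gaugeInv := fun g U => by
    by_cases hU : U ∈ T
    · rw [Set.indicator_of_mem hU, Set.indicator_of_mem ((hTg g U).2 hU), hψ.gaugeInv g U]
    · rw [Set.indicator_of_notMem hU, Set.indicator_of_notMem (fun h => hU ((hTg g U).1 h))]
  zeroFlux := fun k z hz U => by
    by_cases hU : U ∈ T
    · rw [Set.indicator_of_mem hU, Set.indicator_of_mem ((hTz k z hz U).2 hU), hψ.zeroFlux k z hz U]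
    · rw [Set.indicator_of_notMem hU, Set.indicator_of_notMem (fun h => hU ((hTz k z hz U).1 h))]

omit [NeZero L] in
/-- The complementary cut-off `1_{Tᶜ} ψ` is physical as well. [folklore] -/
theorem isPhys_indicator_compl {T : Set (GaugeConfig 3 L SU2)} (hT : MeasurableSet T)
    (hTg : ∀ (g : Site 3 L → SU2) (U : GaugeConfig 3 L SU2), gaugeTransform g U ∈ T ↔ U ∈ T)
    (hTz : ∀ (k : Fin 3), ∀ z ∈ Subgroup.center SU2, ∀ U : GaugeConfig 3 L SU2, twist k z U ∈ T ↔ U ∈ T)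
    {ψ : GaugeConfig 3 L SU2 → ℝ} (hψ : IsPhys ψ) : IsPhys (Tᶜ.indicator ψ) :=
  isPhys_indicator hT.compl (fun g U => by rw [Set.mem_compl_iff, Set.mem_compl_iff, hTg g U])
    (fun k z hz U => by rw [Set.mem_compl_iff, Set.mem_compl_iff, hTz k z hz U]) hψ

/-- The action tube `{S ≤ η}` is measurable (the Wilson action is continuous). [folklore] -/
theorem measurableSet_tube (η : ℝ) : MeasurableSet {U : GaugeConfig 3 L SU2 | wilsonAction su2Rep U ≤ η} :=
  measurableSet_le (continuous_wilsonAction su2Rep (d := 3) (L := L) continuous_su2Rep).measurable measurable_const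

/-- The action tube is gauge invariant. [folklore] -/
theorem gaugeTransform_mem_tube (η : ℝ) (g : Site 3 L → SU2) (U : GaugeConfig 3 L SU2) :
    gaugeTransform g U ∈ {U : GaugeConfig 3 L SU2 | wilsonAction su2Rep U ≤ η} ↔
      U ∈ {U : GaugeConfig 3 L SU2 | wilsonAction su2Rep U ≤ η} := by
  simp only [Set.mem_setOf_eq, wilsonAction_gaugeTransform]

/-- The action tube is invariant under central twists. [cite: tHooft1979] -/
theorem twist_mem_tube (η : ℝ) (k : Fin 3) {z : SU2} (hz : z ∈ Subgroup.center SU2) (U : GaugeConfig 3 L SU2) :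
    twist k z U ∈ {U : GaugeConfig 3 L SU2 | wilsonAction su2Rep U ≤ η} ↔
      U ∈ {U : GaugeConfig 3 L SU2 | wilsonAction su2Rep U ≤ η} := by
  simp only [Set.mem_setOf_eq, wilsonAction_twist_of_mem_center su2Rep k hz U]

/-- `1_T ψ` is physical for the action tube `T = {S ≤ η}`. [folklore] -/
theorem isPhys_indicator_tube (η : ℝ) {ψ : GaugeConfig 3 L SU2 → ℝ} (hψ : IsPhys ψ) :
    IsPhys ({U : GaugeConfig 3 L SU2 | wilsonAction su2Rep U ≤ η}.indicator ψ) :=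
  isPhys_indicator (measurableSet_tube η) (gaugeTransform_mem_tube η) (fun k _ hz U => twist_mem_tube η k hz U) hψ

/-- `1_{Tᶜ} ψ` is physical for the action tube `T = {S ≤ η}`. [folklore] -/
theorem isPhys_indicator_tube_compl (η : ℝ) {ψ : GaugeConfig 3 L SU2 → ℝ} (hψ : IsPhys ψ) :
    IsPhys ({U : GaugeConfig 3 L SU2 | wilsonAction su2Rep U ≤ η}ᶜ.indicator ψ) :=
  isPhys_indicator_compl (measurableSet_tube η) (gaugeTransform_mem_tube η) (fun k _ hz U => twist_mem_tube η k hz U) hψ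

/-! ## §2 `l2` bookkeeping for indicator cut-offs -/

/-- `⟨1_T f, g⟩ = ⟨1_T f, 1_T g⟩`. [folklore] -/
theorem l2_indicator_left (T : Set (GaugeConfig 3 L SU2)) (f g : GaugeConfig 3 L SU2 → ℝ) :
    l2 (T.indicator f) g = l2 (T.indicator f) (T.indicator g) := by
  unfold l2
  refine integral_congr_ae (ae_of_all _ fun U => ?_)
  by_cases hU : U ∈ T
  · simp only [Set.indicator_of_mem hU]
  · simp only [Set.indicator_of_notMem hU, zero_mul]

/-- **Splitting of `l2` along `T`/`Tᶜ`**: `⟨f,g⟩ = ⟨1_Tf, 1_Tg⟩ + ⟨1_{Tᶜ}f, 1_{Tᶜ}g⟩` (physical cut-offs, for integrability). [folklore] -/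
theorem l2_eq_indicator_add_compl {T : Set (GaugeConfig 3 L SU2)} {f g : GaugeConfig 3 L SU2 → ℝ}
    (hTf : IsPhys (T.indicator f)) (hTg : IsPhys (T.indicator g)) (hcf : IsPhys (Tᶜ.indicator f)) (hcg : IsPhys (Tᶜ.indicator g)) :
    l2 f g = l2 (T.indicator f) (T.indicator g) + l2 (Tᶜ.indicator f) (Tᶜ.indicator g) := by
  have h : ∀ U, f U * g U = T.indicator f U * T.indicator g U + Tᶜ.indicator f U * Tᶜ.indicator g U := fun U => by
    by_cases hU : U ∈ T
    · rw [Set.indicator_of_mem hU, Set.indicator_of_mem hU,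
        Set.indicator_of_notMem (fun h : U ∈ Tᶜ => (Set.mem_compl_iff T U).1 h hU), zero_mul, add_zero]
    · rw [Set.indicator_of_notMem hU, Set.indicator_of_mem ((Set.mem_compl_iff T U).2 hU),
        Set.indicator_of_mem ((Set.mem_compl_iff T U).2 hU), zero_mul, zero_add]
  unfold l2
  simp only [h]
  exact integral_add (hTf.integrable_mul hTg) (hcf.integrable_mul hcg)

/-- `‖1_T f‖² ≤ ‖f‖²`. [folklore] -/
theorem l2_indicator_self_le {T : Set (GaugeConfig 3 L SU2)} {f : GaugeConfig 3 L SU2 → ℝ}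
    (hTf : IsPhys (T.indicator f)) (hcf : IsPhys (Tᶜ.indicator f)) :
    l2 (T.indicator f) (T.indicator f) ≤ l2 f f := by
  rw [l2_eq_indicator_add_compl hTf hTf hcf hcf]
  linarith [l2_self_nonneg (Tᶜ.indicator f)]

/-- `‖1_{Tᶜ} f‖² ≤ ‖f‖²`. [folklore] -/
theorem l2_indicator_compl_self_le {T : Set (GaugeConfig 3 L SU2)} {f : GaugeConfig 3 L SU2 → ℝ}
    (hTf : IsPhys (T.indicator f)) (hcf : IsPhys (Tᶜ.indicator f)) :
    l2 (Tᶜ.indicator f) (Tᶜ.indicator f) ≤ l2 f f := by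
  rw [l2_eq_indicator_add_compl hTf hTf hcf hcf]
  linarith [l2_self_nonneg (T.indicator f)]

/-! ## §3 Transfer-form bookkeeping: Rayleigh bound, eigen-pairing, symmetric expansions -/

/-- `⟨f, K_β f⟩ ≤ λ₀ ‖f‖²` for every physical `f` (also when `‖f‖² = 0`, by the Schur bound). [cite: ReedSimonIV1978, Thm. XIII.1] -/
theorem qform_le_topValue_mul_l2 {β : ℝ} (hβ : 0 ≤ β) {f : GaugeConfig 3 L SU2 → ℝ} (hf : IsPhys f) :
    qform su2Rep β f f ≤ topValue su2Rep L β * l2 f f := by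
  rcases (l2_self_nonneg f).eq_or_lt with h0 | hpos
  · have h := qform_le_latCE_mul_l2 hβ hf
    rw [← h0, mul_zero] at h ⊢
    exact h
  · have h := rayleigh_le_topValue su2Rep continuous_su2Rep β hf hpos
    rwa [div_le_iff₀ hpos] at h

/-- Pairing with an exact eigenfunction: `K_βΩ = λΩ ⇒ ⟨f, K_β Ω⟩ = λ⟨f, Ω⟩`. [folklore] -/
theorem qform_eigen_right (β : ℝ) {lam : ℝ} {Ω : GaugeConfig 3 L SU2 → ℝ} (heig : transferApply β Ω = lam • Ω)
    (f : GaugeConfig 3 L SU2 → ℝ) : qform su2Rep β f Ω = lam * l2 f Ω := by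
  rw [qform_eq_l2_transferApply, heig, l2_comm, l2_smul_left, l2_comm]

/-- The transfer form is homogeneous in its second argument (physical test functions). [folklore] -/
theorem qform_smul_right (β a : ℝ) {ψ φ : GaugeConfig 3 L SU2 → ℝ} (hψ : IsPhys ψ) (hφ : IsPhys φ) :
    qform su2Rep β ψ (a • φ) = a * qform su2Rep β ψ φ := by
  rw [qform_su2Rep_comm β hψ (hφ.smul a), qform_smul_left, qform_su2Rep_comm β hφ hψ]

/-- The transfer form is additive in its second argument (physical test functions). [folklore] -/
theorem qform_add_right (β : ℝ) {ψ φ φ' : GaugeConfig 3 L SU2 → ℝ} (hψ : IsPhys ψ) (hφ : IsPhys φ) (hφ' : IsPhys φ') :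
    qform su2Rep β ψ (φ + φ') = qform su2Rep β ψ φ + qform su2Rep β ψ φ' := by
  rw [qform_su2Rep_comm β hψ (hφ.add hφ'), qform_add_left β hφ hφ' hψ, qform_su2Rep_comm β hφ hψ,
    qform_su2Rep_comm β hφ' hψ]

/-- Square expansion: `⟨f+g, K(f+g)⟩ = ⟨f,Kf⟩ + 2⟨f,Kg⟩ + ⟨g,Kg⟩`. [folklore] -/
theorem qform_add_add (β : ℝ) {f g : GaugeConfig 3 L SU2 → ℝ} (hf : IsPhys f) (hg : IsPhys g) :
    qform su2Rep β (f + g) (f + g) = qform su2Rep β f f + 2 * qform su2Rep β f g + qform su2Rep β g g := by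
  rw [qform_add_left β hf hg (hf.add hg), qform_add_right β hf hf hg, qform_add_right β hg hf hg,
    qform_su2Rep_comm β hg hf]
  ring

/-- Square expansion for `l2`: `‖f+g‖² = ‖f‖² + 2⟨f,g⟩ + ‖g‖²`. [folklore] -/
theorem l2_add_add {f g : GaugeConfig 3 L SU2 → ℝ} (hf : IsPhys f) (hg : IsPhys g) :
    l2 (f + g) (f + g) = l2 f f + 2 * l2 f g + l2 g g := by
  rw [l2_add_left hf hg (hf.add hg), l2_comm f (f + g), l2_comm g (f + g), l2_add_left hf hg hf, l2_add_left hf hg hg,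
    l2_comm g f]
  ring

/-! ## §4 The two estimates: tail of the ground state and off-tube cross terms -/

/-- ★ **Ground-state tail off the tube.**  If `K_βΩ = λ₀Ω` (`Ω` physical) and `Tᶜ ⊆ {S ≥ η}`, then
`λ₀ · ‖1_{Tᶜ}Ω‖² ≤ e^{−βη} c_β^{|E|} · ‖Ω‖²`: `λ₀‖w‖² = ⟨w, K_βΩ⟩ ≤ √(⟨w,Kw⟩⟨Ω,KΩ⟩) ≤ √(e^{−βη}c_β^{|E|}‖w‖² · λ₀‖Ω‖²)` (`w = 1_{Tᶜ}Ω`).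
[cite: Luscher1983, §2] -/
theorem tail_bound {β : ℝ} (hβ : 0 ≤ β) {η : ℝ} {T : Set (GaugeConfig 3 L SU2)}
    (hTη : ∀ U, U ∉ T → η ≤ wilsonAction su2Rep U)
    {Ω : GaugeConfig 3 L SU2 → ℝ} (hΩ : IsPhys Ω) (hw : IsPhys (Tᶜ.indicator Ω))
    (heig : transferApply β Ω = topValue su2Rep L β • Ω) :
    topValue su2Rep L β * l2 (Tᶜ.indicator Ω) (Tᶜ.indicator Ω) ≤ Real.exp (-(β * η)) * latCE L β * l2 Ω Ω := by
  set lam := topValue su2Rep L β with hlam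
  set w := Tᶜ.indicator Ω with hwdef
  set κ := Real.exp (-(β * η)) * latCE L β with hκ
  have hlam0 : 0 < lam := topValue_su2Rep_pos L β
  have hκ0 : 0 ≤ κ := mul_nonneg (Real.exp_pos _).le (latCE_pos hβ).le
  have hN0 : 0 ≤ l2 Ω Ω := l2_self_nonneg Ω
  have hSw0 : 0 ≤ l2 w w := l2_self_nonneg w
  -- λ‖w‖² = ⟨w, KΩ⟩
  have h1 : qform su2Rep β w Ω = lam * l2 w w := by
    rw [qform_eigen_right β heig, hwdef, l2_indicator_left]
  have h2 : qform su2Rep β Ω Ω = lam * l2 Ω Ω := qform_eigen_right β heig Ω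
  have h3 : qform su2Rep β w w ≤ κ * l2 w w := by
    have h := qform_le_exp_neg_of_action_ge_lat hβ hw (η := η) fun U hU => hTη U fun hUT =>
      hU (Set.indicator_of_notMem (fun h : U ∈ Tᶜ => (Set.mem_compl_iff T U).1 h hUT) Ω)
    simpa only [hκ, mul_assoc] using h
  have h4 : (lam * l2 w w) ^ 2 ≤ (κ * l2 w w) * (lam * l2 Ω Ω) := by
    rw [← h1, ← h2]
    exact (sq_qform_le hβ hw hΩ).trans (mul_le_mul_of_nonneg_right h3 (by rw [h2]; positivity))
  -- divide by `λ‖w‖²` when it is positive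
  rcases hSw0.eq_or_lt with h0 | hpos
  · rw [← h0, mul_zero]; positivity
  · have hx : 0 < lam * l2 w w := mul_pos hlam0 hpos
    have h5 : (lam * l2 w w) * (lam * l2 w w) ≤ (κ * l2 Ω Ω) * (lam * l2 w w) := by
      calc (lam * l2 w w) * (lam * l2 w w) = (lam * l2 w w) ^ 2 := by ring
        _ ≤ (κ * l2 w w) * (lam * l2 Ω Ω) := h4
        _ = (κ * l2 Ω Ω) * (lam * l2 w w) := by ring
    exact le_of_mul_le_mul_right h5 hx

/-- ★ **Off-tube cross terms.**  For physical `f` and physical `g` supported in `{S ≥ η}`: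
`⟨f, K_β g⟩² ≤ (λ₀‖f‖²) · (e^{−βη}c_β^{|E|}‖g‖²)` (Cauchy–Schwarz for the positive form, Rayleigh bound, large-field suppression).
[cite: Luscher1983, §2] -/
theorem sq_cross_le {β : ℝ} (hβ : 0 ≤ β) {η : ℝ} {f g : GaugeConfig 3 L SU2 → ℝ} (hf : IsPhys f) (hg : IsPhys g)
    (hgη : ∀ U, g U ≠ 0 → η ≤ wilsonAction su2Rep U) :
    qform su2Rep β f g ^ 2 ≤ (topValue su2Rep L β * l2 f f) * (Real.exp (-(β * η)) * latCE L β * l2 g g) :=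
  (sq_qform_le hβ hf hg).trans (mul_le_mul (qform_le_topValue_mul_l2 hβ hf) (qform_le_exp_neg_of_action_ge_lat hβ hg hgη)
    (qform_su2Rep_self_nonneg hβ hg) (mul_nonneg (topValue_su2Rep_pos L β).le (l2_self_nonneg f)))

/-! ## §5 The asymptotic smallness condition -/

/-- For `θ < 1` and `c > 0`: `β² · e^{−β·β^{−θ}} ≤ c` for all large `β` (`β·β^{−θ} = β^{1−θ} → ∞` faster than any logarithm). [folklore] -/
theorem eventually_sq_mul_exp_le {θ : ℝ} (hθ1 : θ < 1) {c : ℝ} (hc : 0 < c) :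
    ∃ β0 : ℝ, ∀ β : ℝ, β0 ≤ β → β ^ 2 * Real.exp (-(β * β ^ (-θ))) ≤ c := by
  set s : ℝ := 1 - θ with hs
  have hs0 : 0 < s := by rw [hs]; linarith
  have h1 : Tendsto (fun x : ℝ => x ^ (2 / s) * Real.exp (-1 * x)) atTop (𝓝 0) :=
    tendsto_rpow_mul_exp_neg_mul_atTop_nhds_zero (2 / s) 1 one_pos
  have h2 : Tendsto (fun β : ℝ => β ^ s) atTop atTop := tendsto_rpow_atTop hs0
  have h3 : ∀ᶠ β : ℝ in atTop, (fun x : ℝ => x ^ (2 / s) * Real.exp (-1 * x)) (β ^ s) ∈ Set.Iio c :=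
    (h1.comp h2).eventually_mem (Iio_mem_nhds hc)
  obtain ⟨β1, hβ1⟩ := Filter.eventually_atTop.1 h3
  refine ⟨max β1 1, fun β hβ => ?_⟩
  have hβ1' : β1 ≤ β := (le_max_left _ _).trans hβ
  have hβpos : 0 < β := lt_of_lt_of_le one_pos ((le_max_right _ _).trans hβ)
  have hle : (β ^ s) ^ (2 / s) * Real.exp (-1 * β ^ s) ≤ c := le_of_lt (Set.mem_Iio.1 (hβ1 β hβ1'))
  have e0 : s * (2 / s) = 2 := by field_simp
  have e1 : (β ^ s) ^ (2 / s) = β ^ 2 := by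
    rw [← Real.rpow_mul hβpos.le, e0, Real.rpow_two]
  have e2 : -1 * β ^ s = -(β * β ^ (-θ)) := by
    rw [hs, Real.rpow_sub hβpos, Real.rpow_one, Real.rpow_neg hβpos.le, div_eq_mul_inv]
    ring
  simp only [e1, e2] at hle
  exact hle

end OffTube

end Summit.QuantumFields.YangMills.Theorems.FemtoTransferGap

end
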